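import Literature.NumberTheory.GaloisRepresentations.CoeffDescent
import HarnessLib

/-!
# Invariance of the `τ`-components of `D(ρ)` under change of frame and of coefficient model

For a period-ring datum `𝔅`, a coefficient field `E` and a framed representation
`ρ : Γ → GL_n(E)` we PROVE:

* **change of frame** (`conjMap`, `labelD_conj`, `labelFilD_conj`,
  `labelledHodgeTateWeights_conj`): conjugating `ρ` by `Q ∈ GL_n(E)` transports `D_τ(ρ)` and its
  filtration along the automorphism `Q ⊗ 1` of `Eⁿ ⊗_P B`; in particular the labelled
  Hodge–Tate weights `HT_τ` are invariant under change of frame;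
* **change of coefficient model** (`labelD_baseChange_eq_span`, `finrank_labelD_baseChange`):
  for `r₀ : Γ → GL_n(E₀)` with `E₀ ⊇ P` splitting `F` and its base change `r` to `E ⊇ E₀`,
  `D_τ(r) = E · ι(D_{τ₀}(r₀))` when `τ = (E₀ → E) ∘ τ₀`, so `dim_E D_τ(r) = dim_{E₀} D_{τ₀}(r₀)`
  (`CoeffDescent` + the decomposition `CoefficientEigenspaces`).

These are the standard independence statements behind "`HT_τ(ρ)` is well defined for
`ρ : Γ_K → GL_n(ℚ̄_p)`" (Patrikis 2019, §2.7.1; Buzzard–Gee §2.2).  No named facts, no `sorry`.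

## References

* S. Patrikis, *Variations on a theorem of Tate*, Mem. AMS 258 (2019), §2.3.1, §2.7.1. [Patrikis2019]
-/

noncomputable section

open TensorProduct Module Matrix
open scoped MatrixGroups

namespace Literature.NumberTheory.GaloisRepresentations

namespace PeriodRingData

universe u v v' w

-- Mathlib's own global value of `maxSynthPendingDepth` (see `LabelledWeightsTwist`); the large
-- tensor types also need a higher instance-synthesis budget.
set_option maxSynthPendingDepth 3
set_option synthInstance.maxHeartbeats 100000

/-! ### Change of frame -/

section Conj

variable {Γ : Type u} [Group Γ] [TopologicalSpace Γ] {P : Type v} {F : Type v'} [Field P] [Field F] [Algebra P F]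
  {E : Type w} [Field E] [Algebra P E] [TopologicalSpace E] [IsTopologicalRing E]
  (𝔅 : PeriodRingData.{u, v, v', _} Γ P F) {n : ℕ}

/-- The linear automorphism `v ↦ Q v` of `Eⁿ` for `Q ∈ GL_n(E)`. [folklore] -/
def glLinearEquiv (Q : GL (Fin n) E) : (Fin n → E) ≃ₗ[E] (Fin n → E) :=
  LinearEquiv.ofLinear (Matrix.toLin' (Q : Matrix (Fin n) (Fin n) E)) (Matrix.toLin' ((Q⁻¹ : GL (Fin n) E) : Matrix (Fin n) (Fin n) E))
    (by rw [← Matrix.toLin'_mul, Units.mul_inv, Matrix.toLin'_one])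
    (by rw [← Matrix.toLin'_mul, Units.inv_mul, Matrix.toLin'_one])

omit [TopologicalSpace E] [IsTopologicalRing E] in
/-- `glLinearEquiv Q v = Q v`. [folklore] -/
@[simp] theorem glLinearEquiv_apply (Q : GL (Fin n) E) (v : Fin n → E) :
    glLinearEquiv Q v = (Q : Matrix (Fin n) (Fin n) E) *ᵥ v :=
  Matrix.toLin'_apply _ _

/-- **The change-of-frame map `Q ⊗ 1` on `Eⁿ ⊗_P B`.** [folklore] -/
def conjMap (Q : GL (Fin n) E) : (Fin n → E) ⊗[P] 𝔅.B ≃ₗ[E] (Fin n → E) ⊗[P] 𝔅.B :=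
  AlgebraTensorModule.congr (glLinearEquiv Q) (LinearEquiv.refl P 𝔅.B)

omit [TopologicalSpace Γ] [TopologicalSpace E] [IsTopologicalRing E] in
/-- `conjMap` on pure tensors. [folklore] -/
@[simp] theorem conjMap_tmul (Q : GL (Fin n) E) (m : Fin n → E) (b : 𝔅.B) :
    𝔅.conjMap Q (m ⊗ₜ[P] b) = ((Q : Matrix (Fin n) (Fin n) E) *ᵥ m) ⊗ₜ[P] b := by
  simp [conjMap]

variable (ρ : FramedRep Γ E n)

/-- **`Q ⊗ 1` intertwines the diagonal actions of `ρ` and of `Q ρ Q⁻¹`.** [folklore] -/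
theorem conjMap_coeffTensorRep (Q : GL (Fin n) E) (σ : Γ) (x : (Fin n → E) ⊗[P] 𝔅.B) :
    𝔅.conjMap Q (𝔅.coeffTensorRep (FramedRep.toContinuousRep ρ) σ x) =
      𝔅.coeffTensorRep (FramedRep.toContinuousRep (ρ.conj Q)) σ (𝔅.conjMap Q x) := by
  induction x using TensorProduct.induction_on with
  | zero => simp
  | tmul m b =>
    rw [coeffTensorRep_apply_tmul, FramedRep.toContinuousRep_apply_apply, conjMap_tmul, conjMap_tmul,
      coeffTensorRep_apply_tmul, FramedRep.toContinuousRep_apply_apply, FramedRep.conj_apply, Units.val_mul, Units.val_mul]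
    congr 1
    rw [Matrix.mulVec_mulVec, Matrix.mulVec_mulVec, Matrix.mul_assoc ((Q : Matrix (Fin n) (Fin n) E) * _), Units.inv_mul,
      Matrix.mul_one]
  | add x y hx hy => rw [map_add, map_add, hx, hy, map_add, map_add]

omit [TopologicalSpace Γ] [TopologicalSpace E] [IsTopologicalRing E] in
/-- `Q ⊗ 1` commutes with the `F`-action. [folklore] -/
theorem conjMap_baseAct (Q : GL (Fin n) E) (f : F) (x : (Fin n → E) ⊗[P] 𝔅.B) :
    𝔅.conjMap Q (𝔅.baseAct E (Fin n → E) f x) = 𝔅.baseAct E (Fin n → E) f (𝔅.conjMap Q x) := by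
  induction x using TensorProduct.induction_on with
  | zero => simp
  | tmul m b => rw [baseAct_tmul, conjMap_tmul, conjMap_tmul, baseAct_tmul]
  | add x y hx hy => rw [map_add, map_add, hx, hy, map_add, map_add]

omit [TopologicalSpace Γ] [TopologicalSpace E] [IsTopologicalRing E] in
/-- `Q ⊗ 1` preserves `M ⊗ Fil^i B`. [folklore] -/
theorem map_conjMap_coeffFilTensor_le (Q : GL (Fin n) E) (i : ℤ) :
    (𝔅.coeffFilTensor E (Fin n → E) i).map (𝔅.conjMap Q).toLinearMap ≤ 𝔅.coeffFilTensor E (Fin n → E) i := by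
  rintro _ ⟨x, ⟨y, rfl⟩, rfl⟩
  induction y using TensorProduct.induction_on with
  | zero => simp
  | tmul m b =>
    refine ⟨((Q : Matrix (Fin n) (Fin n) E) *ᵥ m) ⊗ₜ b, ?_⟩
    change _ = 𝔅.conjMap Q (m ⊗ₜ[P] (b : 𝔅.B))
    rw [conjMap_tmul]
    rfl
  | add x y hx hy => rw [map_add, map_add]; exact add_mem hx hy

/-- `Q ⊗ 1` maps `D_τ(ρ)` into `D_τ(Q ρ Q⁻¹)`. [folklore] -/
theorem map_conjMap_labelD_le (Q : GL (Fin n) E) (τ : F →+* E) :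
    (𝔅.labelD (FramedRep.toContinuousRep ρ) τ).map (𝔅.conjMap Q).toLinearMap ≤
      𝔅.labelD (FramedRep.toContinuousRep (ρ.conj Q)) τ := by
  rintro _ ⟨x, hx, rfl⟩
  refine ⟨fun σ => ?_, fun f => ?_⟩
  · change 𝔅.coeffTensorRep (FramedRep.toContinuousRep (ρ.conj Q)) σ (𝔅.conjMap Q x) = 𝔅.conjMap Q x
    rw [← conjMap_coeffTensorRep, hx.1 σ]
  · change 𝔅.baseAct E (Fin n → E) f (𝔅.conjMap Q x) = τ f • 𝔅.conjMap Q x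
    rw [← conjMap_baseAct, hx.2 f, map_smul]

/-- `conj Q⁻¹ (conj Q ρ) = ρ` (local copy of `FramedRep.conj_inv_conj` of the accepted
`GlobalTriangulineSpace`, not imported here to keep the import closure small). [folklore] -/
private theorem conj_inv_conj_aux
    (Q : GL (Fin n) E) : (ρ.conj Q).conj Q⁻¹ = ρ := by
  refine ContinuousMonoidHom.ext fun g => ?_
  rw [FramedRep.conj_apply, FramedRep.conj_apply, inv_inv]
  group

omit [TopologicalSpace Γ] [TopologicalSpace E] [IsTopologicalRing E] in
/-- `conjMap Q⁻¹` is the inverse of `conjMap Q`. [folklore] -/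
theorem conjMap_inv_apply (Q : GL (Fin n) E) (x : (Fin n → E) ⊗[P] 𝔅.B) : 𝔅.conjMap Q⁻¹ (𝔅.conjMap Q x) = x := by
  induction x using TensorProduct.induction_on with
  | zero => simp
  | tmul m b => rw [conjMap_tmul, conjMap_tmul, Matrix.mulVec_mulVec, Units.inv_mul, Matrix.one_mulVec]
  | add x y hx hy => rw [map_add, map_add, hx, hy]

/-- **`D_τ(Q ρ Q⁻¹) = (Q ⊗ 1) D_τ(ρ)`.** [folklore] -/
theorem labelD_conj (Q : GL (Fin n) E) (τ : F →+* E) :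
    𝔅.labelD (FramedRep.toContinuousRep (ρ.conj Q)) τ = (𝔅.labelD (FramedRep.toContinuousRep ρ) τ).map (𝔅.conjMap Q).toLinearMap := by
  refine le_antisymm (fun x hx => ?_) (𝔅.map_conjMap_labelD_le ρ Q τ)
  have h := 𝔅.map_conjMap_labelD_le (ρ.conj Q) Q⁻¹ τ ⟨x, hx, rfl⟩
  rw [conj_inv_conj_aux] at h
  exact ⟨_, h, by change 𝔅.conjMap Q (𝔅.conjMap Q⁻¹ x) = x; simpa using 𝔅.conjMap_inv_apply Q⁻¹ x⟩

omit [TopologicalSpace Γ] [TopologicalSpace E] [IsTopologicalRing E] in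
/-- **`(Q ⊗ 1)(M ⊗ Fil^i B) = M ⊗ Fil^i B`.** [folklore] -/
theorem map_conjMap_coeffFilTensor (Q : GL (Fin n) E) (i : ℤ) :
    (𝔅.coeffFilTensor E (Fin n → E) i).map (𝔅.conjMap Q).toLinearMap = 𝔅.coeffFilTensor E (Fin n → E) i := by
  refine le_antisymm (𝔅.map_conjMap_coeffFilTensor_le Q i) fun x hx => ?_
  have h := 𝔅.map_conjMap_coeffFilTensor_le Q⁻¹ i ⟨x, hx, rfl⟩
  exact ⟨_, h, by change 𝔅.conjMap Q (𝔅.conjMap Q⁻¹ x) = x; simpa using 𝔅.conjMap_inv_apply Q⁻¹ x⟩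

/-- **`Fil^i D_τ(Q ρ Q⁻¹) = (Q ⊗ 1) Fil^i D_τ(ρ)`.** [folklore] -/
theorem labelFilD_conj (Q : GL (Fin n) E) (τ : F →+* E) (i : ℤ) :
    𝔅.labelFilD (FramedRep.toContinuousRep (ρ.conj Q)) τ i =
      (𝔅.labelFilD (FramedRep.toContinuousRep ρ) τ i).map (𝔅.conjMap Q).toLinearMap := by
  rw [labelFilD, labelFilD, Submodule.map_inf _ (𝔅.conjMap Q).injective, ← labelD_conj, map_conjMap_coeffFilTensor]

/-- **The labelled Hodge–Tate weights are invariant under change of frame.** [cite: Patrikis2019, §2.7.1] -/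
theorem labelledHodgeTateWeights_conj (Q : GL (Fin n) E) (τ : F →+* E) :
    𝔅.labelledHodgeTateWeights (FramedRep.toContinuousRep (ρ.conj Q)) τ =
      𝔅.labelledHodgeTateWeights (FramedRep.toContinuousRep ρ) τ := by
  rw [labelledHodgeTateWeights_def, labelledHodgeTateWeights_def]
  congr 1
  funext i
  rw [labelFilD_conj, LinearEquiv.finrank_map_eq]

/-- In particular `dim_E D_τ` is invariant under change of frame. [folklore] -/
theorem finrank_labelD_conj (Q : GL (Fin n) E) (τ : F →+* E) :
    Module.finrank E (𝔅.labelD (FramedRep.toContinuousRep (ρ.conj Q)) τ) =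
      Module.finrank E (𝔅.labelD (FramedRep.toContinuousRep ρ) τ) := by
  rw [labelD_conj, LinearEquiv.finrank_map_eq]

end Conj

/-! ### Change of coefficient model -/

section Model

variable {Γ : Type u} [Group Γ] [TopologicalSpace Γ] {P : Type v} {F : Type v'} [Field P] [Field F] [Algebra P F]
  {E₀ E : Type*} [Field E₀] [Field E] [Algebra P E₀] [Algebra P E] [Algebra E₀ E] [IsScalarTower P E₀ E]
  [TopologicalSpace E₀] [TopologicalSpace E] [IsTopologicalRing E₀] [IsTopologicalRing E]
  (𝔅 : PeriodRingData.{u, v, v', _} Γ P F) {n : ℕ} (r₀ : FramedRep Γ E₀ n) (hc : Continuous (algebraMap E₀ E))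

/-- The embedding `F → E` obtained from `τ₀ : F → E₀`. [folklore] -/
abbrev extEmb (τ₀ : F →ₐ[P] E₀) : F →ₐ[P] E := (IsScalarTower.toAlgHom P E₀ E).comp τ₀

omit [TopologicalSpace E₀] [TopologicalSpace E] [IsTopologicalRing E₀] [IsTopologicalRing E] in
/-- `extEmb τ₀` as a ring homomorphism is `(E₀ → E) ∘ τ₀`. [folklore] -/
theorem extEmb_toRingHom_apply (τ₀ : F →ₐ[P] E₀) (f : F) : (extEmb (E := E) τ₀).toRingHom f = algebraMap E₀ E (τ₀ f) := rfl

/-- `ι` maps `D_{τ₀}(r₀)` into `D_τ(r)`. [folklore] -/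
theorem coeffIncl_mem_labelD (τ₀ : F →ₐ[P] E₀) {x : (Fin n → E₀) ⊗[P] 𝔅.B}
    (hx : x ∈ 𝔅.labelD (FramedRep.toContinuousRep r₀) τ₀.toRingHom) :
    𝔅.coeffIncl (E := E) n x ∈
      𝔅.labelD (FramedRep.toContinuousRep (r₀.baseChange (algebraMap E₀ E) hc)) (extEmb (E := E) τ₀).toRingHom := by
  refine ⟨fun σ => ?_, fun f => ?_⟩
  · change 𝔅.coeffTensorRep _ σ (𝔅.coeffIncl (E := E) n x) = 𝔅.coeffIncl (E := E) n x
    rw [← coeffIncl_coeffTensorRep, hx.1 σ]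
  · rw [← coeffIncl_baseAct, hx.2 f, LinearMap.map_smul_of_tower, extEmb_toRingHom_apply]
    change _ = algebraMap E₀ E (τ₀ f) • 𝔅.coeffIncl (E := E) n x
    rw [algebraMap_smul]
    rfl

variable [FiniteDimensional P F] [Algebra.IsSeparable P F]

/-- **`D_τ` commutes with extension of the coefficient model**: for `E₀` splitting `F`,
`D_τ(r) = E · ι(D_{τ₀}(r₀))` where `τ = (E₀ → E) ∘ τ₀`. [cite: Patrikis2019, §2.7.1] -/
theorem labelD_baseChange_eq_span (hsplit₀ : Fintype.card (F →ₐ[P] E₀) = Module.finrank P F) (τ₀ : F →ₐ[P] E₀) :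
    𝔅.labelD (FramedRep.toContinuousRep (r₀.baseChange (algebraMap E₀ E) hc)) (extEmb (E := E) τ₀).toRingHom =
      Submodule.span E (𝔅.coeffIncl n '' (𝔅.labelD (FramedRep.toContinuousRep r₀) τ₀.toRingHom : Set ((Fin n → E₀) ⊗[P] 𝔅.B))) := by
  classical
  refine le_antisymm ?_ ?_
  · intro x hx
    -- `x` lies in `E · ι(D(r₀))`
    have hxD : x ∈ Submodule.span E (𝔅.coeffIncl n '' (𝔅.coeffD (FramedRep.toContinuousRep r₀) : Set ((Fin n → E₀) ⊗[P] 𝔅.B))) := by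
      rw [← coeffD_baseChange_eq_span]
      exact hx.1
    obtain ⟨k, c, g, hsum⟩ := Submodule.mem_span_set'.1 hxD
    -- decompose each `g j` along the components
    have hdec : ∀ j : Fin k, ∃ z : (F →ₐ[P] E₀) → (Fin n → E₀) ⊗[P] 𝔅.B,
        (∀ τ', z τ' ∈ 𝔅.labelD (FramedRep.toContinuousRep r₀) τ'.toRingHom) ∧ ∑ τ', 𝔅.coeffIncl n (z τ') = (g j : (Fin n → E) ⊗[P] 𝔅.B) := by
      intro j
      obtain ⟨y, hy, hyj⟩ := (g j).2
      obtain ⟨z, hz, hzsum⟩ := CoeffEigen.exists_sum_eq (U := 𝔅.coeffD (FramedRep.toContinuousRep r₀))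
        (𝔅.coeffDAct (FramedRep.toContinuousRep r₀)) hsplit₀ (⟨y, hy⟩ : 𝔅.coeffD (FramedRep.toContinuousRep r₀))
      refine ⟨fun τ' => ((z τ' : 𝔅.coeffD (FramedRep.toContinuousRep r₀)) : (Fin n → E₀) ⊗[P] 𝔅.B),
        fun τ' => (𝔅.mem_eigenSub_coeffDAct_iff _ τ' _).1 (hz τ'), ?_⟩
      rw [← hyj, ← map_sum, ← Submodule.coe_sum, hzsum]
    choose z hz hzsum using hdec
    -- the components of `x`
    let w : (F →ₐ[P] E₀) → (Fin n → E) ⊗[P] 𝔅.B := fun τ' => ∑ j, c j • 𝔅.coeffIncl n (z j τ')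
    have hwmem : ∀ τ', w τ' ∈ Submodule.span E (𝔅.coeffIncl n ''
        (𝔅.labelD (FramedRep.toContinuousRep r₀) τ'.toRingHom : Set ((Fin n → E₀) ⊗[P] 𝔅.B))) := fun τ' =>
      Submodule.sum_mem _ fun j _ => Submodule.smul_mem _ _ (Submodule.subset_span ⟨_, hz j τ', rfl⟩)
    have hxw : x = ∑ τ', w τ' := by
      rw [← hsum, Finset.sum_comm]
      refine Finset.sum_congr rfl fun j _ => ?_
      rw [← Finset.smul_sum, hzsum j]
    -- eigenspaces in `Eⁿ ⊗ B` for the embeddings through `E₀` are independent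
    let V : (F →ₐ[P] E₀) → Submodule E ((Fin n → E) ⊗[P] 𝔅.B) :=
      fun τ' => CoeffEigen.eigenSub (𝔅.baseActAlgHom E (Fin n → E)) (extEmb (E := E) τ')
    have hVind : iSupIndep V := by
      have hinj : Function.Injective fun τ' : F →ₐ[P] E₀ => extEmb (E := E) τ' := by
        intro τ₁ τ₂ h
        ext f
        have := DFunLike.congr_fun h f
        exact (algebraMap E₀ E).injective this
      exact (CoeffEigen.eigenSub_iSupIndep (𝔅.baseActAlgHom E (Fin n → E))).comp hinj
    have hspanV : ∀ τ', Submodule.span E (𝔅.coeffIncl n ''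
        (𝔅.labelD (FramedRep.toContinuousRep r₀) τ'.toRingHom : Set ((Fin n → E₀) ⊗[P] 𝔅.B))) ≤ V τ' := by
      intro τ'
      rw [Submodule.span_le]
      rintro _ ⟨y, hy, rfl⟩ f
      exact (𝔅.coeffIncl_mem_labelD r₀ hc τ' hy).2 f
    have hxV : x ∈ V τ₀ := fun f => hx.2 f
    -- uniqueness of the decomposition
    let w' : (F →ₐ[P] E₀) → (Fin n → E) ⊗[P] 𝔅.B := fun τ' => w τ' - if τ' = τ₀ then x else 0
    have hw' : ∀ τ', w' τ' = 0 := by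
      refine CoeffEigen.eq_zero_of_sum_eq_zero hVind w' (fun τ' => ?_) ?_
      · refine Submodule.sub_mem _ (hspanV τ' (hwmem τ')) ?_
        split_ifs with h
        · subst h; exact hxV
        · exact zero_mem _
      · simp only [w', Finset.sum_sub_distrib, Finset.sum_ite_eq', Finset.mem_univ, if_true, ← hxw, sub_self]
    have hxeq : x = w τ₀ := by
      have h0 : w τ₀ - x = 0 := by simpa [w'] using hw' τ₀
      exact (sub_eq_zero.1 h0).symm
    rw [hxeq]
    exact hwmem τ₀
  · rw [Submodule.span_le]
    rintro _ ⟨y, hy, rfl⟩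
    exact 𝔅.coeffIncl_mem_labelD r₀ hc τ₀ hy

/-- **`dim_E D_τ(r) = dim_{E₀} D_{τ₀}(r₀)`** for the base change `r` of `r₀` and `τ = (E₀ → E) ∘ τ₀`. [cite: Patrikis2019, §2.7.1] -/
theorem finrank_labelD_baseChange (hsplit₀ : Fintype.card (F →ₐ[P] E₀) = Module.finrank P F) (τ₀ : F →ₐ[P] E₀)
    [FiniteDimensional E₀ (𝔅.labelD (FramedRep.toContinuousRep r₀) τ₀.toRingHom)] :
    Module.finrank E (𝔅.labelD (FramedRep.toContinuousRep (r₀.baseChange (algebraMap E₀ E) hc)) (extEmb (E := E) τ₀).toRingHom) =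
      Module.finrank E₀ (𝔅.labelD (FramedRep.toContinuousRep r₀) τ₀.toRingHom) := by
  rw [labelD_baseChange_eq_span 𝔅 r₀ hc hsplit₀ τ₀]
  exact 𝔅.finrank_span_coeffIncl_image (𝔅.labelD (FramedRep.toContinuousRep r₀) τ₀.toRingHom)

end Model

end PeriodRingData

end Literature.NumberTheory.GaloisRepresentations

end
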